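import Literature.NumberTheory.DiophantineGeometry.AbcWave0
import HarnessLib

/-!
# Fermat–Catalan (abc.S18): what is provable about `Literature.NumberTheory.DiophantineGeometry.FermatCatalanConjecture`

`Literature.NumberTheory.DiophantineGeometry.FermatCatalanConjecture` (`AbcWave0`) is the Fermat–Catalan conjecture of
Darmon–Granville, *On the equations `z ^ m = F(x, y)` and `A x ^ p + B y ^ q = C z ^ r`*,
Bull. London Math. Soc. **27** (1995), p. 515: "THE FERMAT–CATALAN CONJECTURE. There are only
finitely many triples of coprime integer powers `x ^ p, y ^ q, z ^ r` for which `x ^ p + y ^ q = z ^ r`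
with `1/p + 1/q + 1/r < 1`." It is an **open conjecture**: loc. cit. deduces it from the abc
conjecture (§5.2), and even single signatures such as `(2, 5, 7)` are open (*Generalised Fermat
equation: a survey of solved cases*, arXiv:2412.11933 (2024), pp. 3–4). Consequently no
`FermatCatalanConjecture_holds` is stated anywhere; the definition stays a hypothesis `(h : …)` for
its users. (The ten known solutions printed on p. 515 are shown to be members of
`Literature.NumberTheory.DiophantineGeometry.fermatCatalanSolutions`, whence `10 ≤ encard`, in
`Literature/Barriers/ABC/TijdemanZagierNeedsExponentThree.lean`.) This file changes no statement of
`AbcWave0`; it only adds, sorry-free: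

* `Literature.NumberTheory.DiophantineGeometry.hyperbolic_exponents_ne_zero`, `Literature.NumberTheory.DiophantineGeometry.two_le_of_hyperbolic_exponents`: the integer
  hyperbolicity test `q r + r p + p q < p q r` of `fermatCatalanSolutions` forces `p, q, r ≥ 2`;
* `Literature.NumberTheory.DiophantineGeometry.pairwise_coprime_iff_gcd_eq_one`: given the equation, pairwise coprimality of `x, y, z`
  (the vendored convention) is equivalent to Darmon–Granville's *properness* `gcd(x, y, z) = 1`
  (p. 513), whence the restatement `Literature.NumberTheory.DiophantineGeometry.fermatCatalanSolutions_eq_setOf_gcd` of the solution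
  set with the printed side condition;
* `Literature.NumberTheory.DiophantineGeometry.darmon_granville_of_fermatCatalanConjecture`: the conjecture refines Darmon–Granville's
  Theorem 2 (`Literature.NumberTheory.DiophantineGeometry.darmon_granville`, finiteness for each fixed hyperbolic signature), because
  `(x, y, z) ↦ (x ^ p, y ^ q, z ^ r)` is injective for `p, q, r ≠ 0` (`Literature.NumberTheory.DiophantineGeometry.powTriple_injective`).
-/

namespace Literature.NumberTheory.DiophantineGeometry

/-! ### The hyperbolicity test and properness -/

/-- The integer form `q r + r p + p q < p q r` of `1/p + 1/q + 1/r < 1` forces all three exponents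
to be non-zero. [folklore] -/
theorem hyperbolic_exponents_ne_zero {p q r : ℕ} (hpqr : q * r + r * p + p * q < p * q * r) :
    p ≠ 0 ∧ q ≠ 0 ∧ r ≠ 0 := by
  refine ⟨?_, ?_, ?_⟩ <;> rintro rfl <;> simp at hpqr

/-- The integer form `q r + r p + p q < p q r` of `1/p + 1/q + 1/r < 1` forces all three exponents
to be at least `2`. [folklore] -/
theorem two_le_of_hyperbolic_exponents {p q r : ℕ} (hpqr : q * r + r * p + p * q < p * q * r) :
    2 ≤ p ∧ 2 ≤ q ∧ 2 ≤ r := by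
  obtain ⟨hp, hq, hr⟩ := hyperbolic_exponents_ne_zero hpqr
  refine ⟨?_, ?_, ?_⟩ <;> by_contra hlt
  · obtain rfl : p = 1 := by omega
    nlinarith
  · obtain rfl : q = 1 := by omega
    nlinarith
  · obtain rfl : r = 1 := by omega
    nlinarith

/-- Given `x ^ p + y ^ q = z ^ r` with non-zero exponents, pairwise coprimality of `x, y, z` (the
convention of `fermatCatalanSolutions`) is equivalent to Darmon–Granville's *properness*
`gcd(x, y, z) = 1` (p. 513: "Call an integer solution `(x, y, z)` … proper if `gcd(x, y, z) = 1`"):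
a prime dividing two of `x, y, z` divides the third through the equation.
[cite: DarmonGranville1995, p. 513] -/
theorem pairwise_coprime_iff_gcd_eq_one {x y z p q r : ℕ} (hp : p ≠ 0) (hq : q ≠ 0) (hr : r ≠ 0)
    (h : x ^ p + y ^ q = z ^ r) :
    (Nat.Coprime x y ∧ Nat.Coprime y z ∧ Nat.Coprime x z) ↔ Nat.gcd (Nat.gcd x y) z = 1 := by
  constructor
  · rintro ⟨hxy, -, -⟩
    rw [Nat.Coprime.gcd_eq_one hxy, Nat.gcd_one_left]
  · intro hg
    -- a common prime factor of all three divides `gcd (gcd x y) z = 1`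
    have key : ∀ k : ℕ, k.Prime → k ∣ x → k ∣ y → k ∣ z → k ∣ 1 := fun k _ hkx hky hkz =>
      hg ▸ Nat.dvd_gcd (Nat.dvd_gcd hkx hky) hkz
    -- and a common prime factor of two of them divides the third, through the equation
    have hxz_of : ∀ k : ℕ, k.Prime → k ∣ x → k ∣ z → k ∣ y := fun k hk hkx hkz =>
      hk.dvd_of_dvd_pow <| (Nat.dvd_add_right (dvd_pow hkx hp)).mp (h ▸ dvd_pow hkz hr)
    have hyz_of : ∀ k : ℕ, k.Prime → k ∣ y → k ∣ z → k ∣ x := fun k hk hky hkz =>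
      hk.dvd_of_dvd_pow <| (Nat.dvd_add_left (dvd_pow hky hq)).mp (h ▸ dvd_pow hkz hr)
    have hxy_of : ∀ k : ℕ, k.Prime → k ∣ x → k ∣ y → k ∣ z := fun k hk hkx hky =>
      hk.dvd_of_dvd_pow <| h ▸ dvd_add (dvd_pow hkx hp) (dvd_pow hky hq)
    exact ⟨Nat.coprime_of_dvd' fun k hk hkx hky => key k hk hkx hky (hxy_of k hk hkx hky),
      Nat.coprime_of_dvd' fun k hk hky hkz => key k hk (hyz_of k hk hky hkz) hky hkz,
      Nat.coprime_of_dvd' fun k hk hkx hkz => key k hk hkx (hxz_of k hk hkx hkz) hkz⟩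

/-- `fermatCatalanSolutions` restated with Darmon–Granville's properness condition
`gcd(x, y, z) = 1` ("triples of coprime integer powers", p. 515; "proper", p. 513) in place of
pairwise coprimality — equivalent by `pairwise_coprime_iff_gcd_eq_one`, the exponents being non-zero
by `hyperbolic_exponents_ne_zero`. [cite: DarmonGranville1995, p. 515] -/
theorem fermatCatalanSolutions_eq_setOf_gcd :
    fermatCatalanSolutions = {t | ∃ x y z p q r : ℕ, 0 < x ∧ 0 < y ∧ 0 < z ∧
      Nat.gcd (Nat.gcd x y) z = 1 ∧
      q * r + r * p + p * q < p * q * r ∧ x ^ p + y ^ q = z ^ r ∧ t = (x ^ p, y ^ q, z ^ r)} := by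
  ext t
  constructor
  · rintro ⟨x, y, z, p, q, r, hx, hy, hz, hxy, hyz, hxz, hpqr, h, rfl⟩
    obtain ⟨hp, hq, hr⟩ := hyperbolic_exponents_ne_zero hpqr
    exact ⟨x, y, z, p, q, r, hx, hy, hz,
      (pairwise_coprime_iff_gcd_eq_one hp hq hr h).mp ⟨hxy, hyz, hxz⟩, hpqr, h, rfl⟩
  · rintro ⟨x, y, z, p, q, r, hx, hy, hz, hg, hpqr, h, rfl⟩
    obtain ⟨hp, hq, hr⟩ := hyperbolic_exponents_ne_zero hpqr
    obtain ⟨hxy, hyz, hxz⟩ := (pairwise_coprime_iff_gcd_eq_one hp hq hr h).mpr hg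
    exact ⟨x, y, z, p, q, r, hx, hy, hz, hxy, hyz, hxz, hpqr, h, rfl⟩

/-! ### The conjecture refines Darmon–Granville's Theorem 2 -/

/-- For non-zero exponents the map `(x, y, z) ↦ (x ^ p, y ^ q, z ^ r)` on `ℕ × ℕ × ℕ` is injective.
[folklore] -/
theorem powTriple_injective {p q r : ℕ} (hp : p ≠ 0) (hq : q ≠ 0) (hr : r ≠ 0) :
    Function.Injective fun t : ℕ × ℕ × ℕ => (t.1 ^ p, t.2.1 ^ q, t.2.2 ^ r) := by
  rintro ⟨x, y, z⟩ ⟨x', y', z'⟩ he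
  simp only [Prod.mk.injEq] at he ⊢
  exact ⟨Nat.pow_left_injective hp he.1, Nat.pow_left_injective hq he.2.1,
    Nat.pow_left_injective hr he.2.2⟩

/-- **Fermat–Catalan refines Darmon–Granville.** The Fermat–Catalan conjecture (finitely many value
triples over *all* hyperbolic signatures at once) implies Darmon–Granville's Theorem 2 as vendored in
`darmon_granville` (for each *fixed* hyperbolic signature `(p, q, r)`, finitely many solutions
`(x, y, z)` in pairwise coprime positive integers): for fixed non-zero exponents the solutions inject
into the value triples. (Theorem 2 is a theorem — via Faltings — while the conjecture is open; this
lemma only records the direction of the dependency between the two records of abc.S18.)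
[cite: DarmonGranville1995, Theorem 2 and p. 515] -/
theorem darmon_granville_of_fermatCatalanConjecture (h : FermatCatalanConjecture) :
    darmon_granville := by
  intro p q r hpqr
  obtain ⟨hp, hq, hr⟩ := hyperbolic_exponents_ne_zero hpqr
  have hfin : fermatCatalanSolutions.Finite := h
  refine Set.Finite.of_finite_image (f := fun t : ℕ × ℕ × ℕ => (t.1 ^ p, t.2.1 ^ q, t.2.2 ^ r))
    (hfin.subset ?_) (powTriple_injective hp hq hr).injOn
  rintro _ ⟨⟨x, y, z⟩, ⟨hx, hy, hz, hxy, hyz, hxz, he⟩, rfl⟩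
  exact ⟨x, y, z, p, q, r, hx, hy, hz, hxy, hyz, hxz, hpqr, he, rfl⟩

end Literature.NumberTheory.DiophantineGeometry
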